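import Summits.Parity.GeneralizedHardyLittlewood.Theorems.LeeYangFibresPrimeCellsRelativeDickson
import Summits.Parity.GeneralizedHardyLittlewood.Theorems.LeeYangFibresPrimeCellsRelativeChowlaDefs
import HarnessLib

/-!
# The crux sliced at `t` forms implies Dickson's conjecture for `t` forms; `t = 2` gives twin primes
# (crux stmt-Parity-14112, route `LeeYangFibres`, line `SketchIdeator4`)

The hardness certificate `Sketch.dickson_injective_of_primeCellsRelative`
(`Theorems/LeeYangFibresPrimeCellsRelativeDickson.lean`) uses the crux `PrimeCellsRelative` of route
`LeeYangFibres` (Parity / GeneralizedHardyLittlewood) only at the number of forms `t` of the family at hand,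
so it localises to the slice `PrimeCellsRelativeAt t`
(`Theorems/LeeYangFibresPrimeCellsRelativeChowlaDefs.lean`):

* `dickson_injective_of_primeCellsRelativeAt` — for an injective admissible family `(aᵢ n + bᵢ)_{i < t}`,
  `t ≥ 1`, `aᵢ ≥ 1`, the slice at `t` gives `m` beyond every bound with all `aᵢ m + bᵢ` prime (the proof
  of the `Sketch` certificate verbatim, the crux being applied at `t` only);
* `twinPrimeConjecture_of_primeCellsRelativeAt_two` (registered stub of stmt-Parity-14112, line
  `SketchIdeator4`) — the PAIR slice `PrimeCellsRelativeAt 2` implies the twin prime conjecture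
  (parity.S03, `Literature.NumberTheory.Sieve.TwinPrimeConjecture`): the family `(n, n + 2)` is injective
  and admissible (`n = 1` gives the product `3`, `n = 2` gives `8`);
* `dicksonConjecture_of_forall_primeCellsRelativeAt` — all slices `t ≥ 1` together give Dickson's
  conjecture (parity.S07), through `primeCellsRelative_iff_forall_at`.

`PrimeCellsRelativeAt 2`, `TwinPrimeConjecture` and `DicksonConjecture` are conjecture-grade and appear only
as hypothesis / conclusion of implications; nothing is asserted about them.

References: L. E. Dickson, Messenger of Math. 33 (1904) 155–161 [Dickson1904]; B. Green, T. Tao,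
Ann. of Math. 171 (2010), Conj. 1.4 [GreenTao2010].
-/

noncomputable section

namespace Summit.Parity.GeneralizedHardyLittlewood.Cruxes.PrimeCellsRelative.SieveOutToChowla

open scoped BigOperators Topology Classical
open Filter Finset MeasureTheory Literature.NumberTheory.Sieve
open Summit.Parity.GeneralizedHardyLittlewood.Theses.LeeYangFibres
open Summit.Parity.GeneralizedHardyLittlewood.Theorems.LeeYangFibresCells
open Summit.Parity.GeneralizedHardyLittlewood.Cruxes.PrimeCellsRelative.Sketch

/-! ### Dickson's conjecture for `t` forms from the slice at `t` -/

/-- **The slice `PrimeCellsRelativeAt t` gives Dickson's conjecture for injective families of `t` forms,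
beyond every bound**: for an injective admissible `(aᵢ n + bᵢ)_{i < t}`, `t ≥ 1`, `aᵢ ≥ 1`, and every `M₀`
there is `m > M₀` with all `aᵢ m + bᵢ` prime — a point of the non-empty cell
`{0 ≤ n ≤ N : every aᵢ n + bᵢ a prime > N^{1/u}}` for `N = max(N₀, N₁, 2, (a₀ M₀ + b₀)^u)`.  The proof of
`Sketch.dickson_injective_of_primeCellsRelative`, the crux being used at `t` only.
[cite: GreenTao2010, Conj. 1.4] -/
theorem dickson_injective_of_primeCellsRelativeAt {t : ℕ} (hP : PrimeCellsRelativeAt t) (ht : 1 ≤ t)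
    (a b : Fin t → ℕ) (ha : ∀ i, 1 ≤ a i) (hinj : Function.Injective fun i => (a i, b i))
    (hadm : ∀ p : ℕ, p.Prime → ∃ n : ℕ, ¬p ∣ ∏ i, (a i * n + b i)) (M₀ : ℕ) :
    ∃ m : ℕ, M₀ < m ∧ ∀ i, (a i * m + b i).Prime := by
  set Ψ : Fin t → AffLinForm 1 := fun i => ⟨fun _ => (a i : ℤ), (b i : ℤ)⟩ with hΨ
  have hnd : IsNondegenerateSystem Ψ := isNondegenerateSystem_dickson a b ha hinj hadm
  have hS : 0 < singularProduct Ψ := singularProduct_dickson_pos a b ha hinj hadm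
  set S := singularProduct Ψ with hSdef
  set ε : ℝ := min (1 / 2) (S / 2 ^ (t + 2)) with hε
  have hε0 : 0 < ε := lt_min (by norm_num) (by positivity)
  obtain ⟨u, hu, N₀, hN₀⟩ := hP (∑ i, (a i + b i)) ε hε0
  have hu0 : u ≠ 0 := by omega
  obtain ⟨N₁, hN₁⟩ := eventually_atTop.mp
    (eventually_primeCounting_window (by norm_num : (0 : ℝ) < 1 / 2))
  set i0 : Fin t := ⟨0, ht⟩ with hi0
  set Q : ℕ := a i0 * M₀ + b i0 with hQ
  set N : ℕ := max (max N₀ N₁) (max 2 (Q ^ u)) with hN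
  have hNN₀ : N₀ ≤ N := le_trans (le_max_left _ _) (le_max_left _ _)
  have hNN₁ : N₁ ≤ N := le_trans (le_max_right _ _) (le_max_left _ _)
  have hN2 : 2 ≤ N := le_trans (le_max_left _ _) (le_max_right _ _)
  have hNQ : Q ^ u ≤ N := le_trans (le_max_right _ _) (le_max_right _ _)
  have hN1 : 1 ≤ N := by omega
  set K : Set (Fin 1 → ℝ) := Set.Icc (fun _ : Fin 1 => (0 : ℝ)) (fun _ => (N : ℝ)) with hK
  have hKc : Convex ℝ K := convex_Icc _ _
  have hKB : K ⊆ realBox 1 N := by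
    refine Set.Icc_subset_Icc (fun _ => ?_) le_rfl
    simp only [Left.neg_nonpos_iff, Nat.cast_nonneg]
  have hb := hN₀ N hNN₀ Ψ hnd (affLinSize_dickson_le a b hN1) K hKc hKB
  have hpos := cell_pos_arith t hb (by exact_mod_cast hN2) (le_archFactor_dickson a b ha N) hS
    (one_le_two_mul_log_mul_roughDensity (hN₁ N hNN₁) hN1 hu) (min_le_left _ _)
    (min_le_right _ _)
  clear_value K
  obtain ⟨n, hn⟩ := Finset.card_pos.mp (Nat.cast_pos.mp hpos)
  obtain ⟨-, hnK, hnP⟩ := Finset.mem_filter.mp hn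
  rw [hK] at hnK
  -- `n₀ ≥ 0`
  have hn0 : 0 ≤ n 0 := by
    have := hnK.1 0
    simp only [realPoint] at this
    exact_mod_cast this
  set m : ℕ := (n 0).toNat with hm
  have hmn : (m : ℤ) = n 0 := Int.toNat_of_nonneg hn0
  have hval : ∀ i, ((Ψ i).eval n).toNat = a i * m + b i := by
    intro i
    rw [DimOne.eval_eq, ← hmn]
    exact Int.toNat_natCast _
  refine ⟨m, ?_, fun i => ?_⟩
  · -- `a₀ m + b₀` is a prime `> N^{1/u} ≥ Q = a₀ M₀ + b₀`
    by_contra hle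
    push Not at hle
    have h1 := (hnP i0).1
    rw [hval i0, Nat.Prime.minFac_eq
      (ArithmeticFunction.cardFactors_eq_one_iff_prime.mp (hval i0 ▸ (hnP i0).2))] at h1
    have h2 : a i0 * m + b i0 ≤ Q := by rw [hQ]; gcongr
    have h3 : (Q : ℝ) ≤ (N : ℝ) ^ ((1 : ℝ) / u) := by
      have hQu : ((Q : ℝ) ^ u) ^ ((1 : ℝ) / u) = Q := by
        rw [one_div]; exact Real.pow_rpow_inv_natCast (Nat.cast_nonneg Q) hu0
      rw [← hQu]
      refine Real.rpow_le_rpow (by positivity) ?_ (by positivity)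
      exact_mod_cast hNQ
    have h4 : ((a i0 * m + b i0 : ℕ) : ℝ) ≤ Q := by exact_mod_cast h2
    linarith
  · have h := (hnP i).2
    rw [hval i] at h
    exact ArithmeticFunction.cardFactors_eq_one_iff_prime.mp h

/-! ### The pair slice: twin primes -/

/-- The twin system `(n, n + 2) = (![1, 1] i · n + ![0, 2] i)_{i < 2}` is admissible: `n = 1` gives the
product `3` (so a fixed prime divisor is `3`) and `n = 2` gives `8` (so it is `2`). [folklore] -/
theorem twin_admissible (p : ℕ) (hp : p.Prime) :
    ∃ n : ℕ, ¬p ∣ ∏ i, ((![1, 1] : Fin 2 → ℕ) i * n + (![0, 2] : Fin 2 → ℕ) i) := by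
  by_cases h3 : p = 3
  · subst h3
    refine ⟨2, ?_⟩
    rw [Fin.prod_univ_two]
    decide
  · refine ⟨1, fun h => h3 ?_⟩
    rw [Fin.prod_univ_two] at h
    simp only [Matrix.cons_val_zero, Matrix.cons_val_one, mul_one, add_zero, one_mul] at h
    exact (Nat.prime_dvd_prime_iff_eq hp Nat.prime_three).mp (by simpa using h)

/-- **The pair slice of the crux implies the twin prime conjecture** (parity.S03): apply
`dickson_injective_of_primeCellsRelativeAt` at `t = 2` to the injective admissible family `(n, n + 2)`
beyond every bound.  Registered stub of crux stmt-Parity-14112 (line `SketchIdeator4`); the hypothesis is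
conjecture-grade and is not asserted. [cite: Dickson1904, p. 155] -/
theorem twinPrimeConjecture_of_primeCellsRelativeAt_two : PrimeCellsRelativeAt 2 → Literature.NumberTheory.Sieve.TwinPrimeConjecture := by
  intro hP n
  have ha : ∀ i : Fin 2, 1 ≤ (![1, 1] : Fin 2 → ℕ) i := by
    intro i
    fin_cases i <;> simp
  have hinj : Function.Injective fun i : Fin 2 => ((![1, 1] : Fin 2 → ℕ) i, (![0, 2] : Fin 2 → ℕ) i) := by
    intro i j hij
    fin_cases i <;> fin_cases j <;> simp_all
  obtain ⟨m, hm, hprime⟩ :=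
    dickson_injective_of_primeCellsRelativeAt hP (by norm_num) ![1, 1] ![0, 2] ha hinj twin_admissible n
  refine ⟨m, hm, ?_, ?_⟩
  · simpa using hprime 0
  · simpa using hprime 1

/-! ### All slices: Dickson's conjecture -/

/-- All slices `PrimeCellsRelativeAt t`, `t ≥ 1`, together give Dickson's conjecture (parity.S07): they
reassemble the crux (`primeCellsRelative_iff_forall_at`), which implies it
(`Sketch.primeCellsRelative_implies_dicksonConjecture`). [cite: Dickson1904, p. 155] -/
theorem dicksonConjecture_of_forall_primeCellsRelativeAt (hP : ∀ t : ℕ, 1 ≤ t → PrimeCellsRelativeAt t) :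
    DicksonConjecture :=
  primeCellsRelative_implies_dicksonConjecture (primeCellsRelative_iff_forall_at.mpr hP)

end Summit.Parity.GeneralizedHardyLittlewood.Cruxes.PrimeCellsRelative.SieveOutToChowla

end
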